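import Mathlib
import HarnessLib
import Literature.Analysis.FluidPDE.TaoAveragedSobolev
import Summits.NavierStokesRegularity.NavierStokesRegularity.Theses.PerpetualPump

/-!
Sketch file for crux-ideate stmt-NavierStokesRegularity-1835 (AveragedTypeIBlowup), ideator 2.
First-lemma signatures of the three idea cards; statements only (no proofs claimed).
-/

noncomputable section

open MeasureTheory Set Filter Topology
open Literature.Analysis.FluidPDE Literature.Analysis.FluidPDE.Tao2016

namespace Summit.NavierStokesRegularity.NavierStokesRegularity.Cruxes.AveragedTypeIBlowup.SketchR1K2

/-! ### Card 1 (threshold-pinning): the boundary-of-globality datum exists for free. -/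

/-- FIRST LEMMA of card `threshold-pinning`: on the ray `A • u₀` through a non-global Schwartz
datum of an averaged NS equation with cancellation, the set of globally solvable amplitudes is
open and contains a neighbourhood of `0`, hence there is a least non-global amplitude `A*`:
the solution from `A* • u₀` is non-global and is a limit (in data) of global solutions. -/
def BoundaryDatum : Prop :=
  ∀ 𝒜 : AveragingDatum, 𝒜.IsSymmetric → 𝒜.HasCancellation →
    ∀ u₀ : SchwartzMap (EuclideanSpace ℝ (Fin 3)) (EuclideanSpace ℝ (Fin 3)),
      VectorCalculus.IsDivFree ⇑u₀ →
      (¬ ∃ u : ℝ → L2C, 𝒜.IsMildSolution (schwartzL2 u₀) (Ici 0) u) →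
      ∃ A : ℝ, 0 < A ∧ A ≤ 1 ∧
        (¬ ∃ u : ℝ → L2C, 𝒜.IsMildSolution (schwartzL2 (A • u₀)) (Ici 0) u) ∧
        ∀ A' : ℝ, 0 ≤ A' → A' < A →
          ∃ u : ℝ → L2C, 𝒜.IsMildSolution (schwartzL2 (A' • u₀)) (Ici 0) u

/-- Openness ingredient of `BoundaryDatum` (global ⇒ eventually small ⇒ stable): the set of
globally solvable amplitudes on a Schwartz ray is open. -/
def GlobalSetOpen : Prop :=
  ∀ 𝒜 : AveragingDatum, 𝒜.IsSymmetric → 𝒜.HasCancellation →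
    ∀ u₀ : SchwartzMap (EuclideanSpace ℝ (Fin 3)) (EuclideanSpace ℝ (Fin 3)),
      VectorCalculus.IsDivFree ⇑u₀ →
      IsOpen {A : ℝ | ∃ u : ℝ → L2C, 𝒜.IsMildSolution (schwartzL2 (A • u₀)) (Ici 0) u}

/-- The RATE half of card 1, as the statement the line must finally prove for ONE datum 𝒜
(e.g. Tao's cascade datum of Thm 1.5): every boundary-of-globality solution obeys the Type-I
bound. Together with `BoundaryDatum` and maximality of non-global mild solutions this gives
`AveragedTypeIBlowup`. -/
def BoundaryBlowupIsTypeI (𝒜 : AveragingDatum) : Prop :=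
  ∀ u₀ : SchwartzMap (EuclideanSpace ℝ (Fin 3)) (EuclideanSpace ℝ (Fin 3)),
    VectorCalculus.IsDivFree ⇑u₀ →
    (∀ A' : ℝ, 0 ≤ A' → A' < 1 →
        ∃ u : ℝ → L2C, 𝒜.IsMildSolution (schwartzL2 (A' • u₀)) (Ici 0) u) →
    ∀ T : ℝ, 0 < T → ∀ u : ℝ → L2C, 𝒜.IsMildSolution (schwartzL2 u₀) (Ico 0 T) u →
      (¬ ∃ T' : ℝ, T < T' ∧ ∃ v : ℝ → L2C,
          𝒜.IsMildSolution (schwartzL2 u₀) (Ico 0 T') v ∧ ∀ t ∈ Ico 0 T, v t = u t) →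
      ∃ M : ℝ, ∀ t ∈ Ico 0 T, eLpNorm (u t) ⊤ volume ≤ ENNReal.ofReal (M / Real.sqrt (T - t))

/-- Sanity: the two halves give the crux (pure logic modulo producing the maximal solution on
`[0,T*)` from non-globality, which is local theory; stated here as a hypothesis `hmax`). -/
theorem crux_of_boundary
    (hmax : ∀ 𝒜 : AveragingDatum, 𝒜.IsSymmetric → 𝒜.HasCancellation →
      ∀ u₀ : SchwartzMap (EuclideanSpace ℝ (Fin 3)) (EuclideanSpace ℝ (Fin 3)),
        VectorCalculus.IsDivFree ⇑u₀ →
        (¬ ∃ u : ℝ → L2C, 𝒜.IsMildSolution (schwartzL2 u₀) (Ici 0) u) →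
        ∃ T : ℝ, 0 < T ∧ ∃ u : ℝ → L2C, 𝒜.IsMildSolution (schwartzL2 u₀) (Ico 0 T) u ∧
          ¬ ∃ T' : ℝ, T < T' ∧ ∃ v : ℝ → L2C,
            𝒜.IsMildSolution (schwartzL2 u₀) (Ico 0 T') v ∧ ∀ t ∈ Ico 0 T, v t = u t)
    (𝒜 : AveragingDatum) (hs : 𝒜.IsSymmetric) (hc : 𝒜.HasCancellation)
    (u₀ : SchwartzMap (EuclideanSpace ℝ (Fin 3)) (EuclideanSpace ℝ (Fin 3)))
    (hdiv : VectorCalculus.IsDivFree ⇑u₀)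
    (hng : ¬ ∃ u : ℝ → L2C, 𝒜.IsMildSolution (schwartzL2 u₀) (Ici 0) u)
    (hB : BoundaryDatum) (hR : BoundaryBlowupIsTypeI 𝒜) :
    Summit.NavierStokesRegularity.NavierStokesRegularity.Theses.PerpetualPump.AveragedTypeIBlowup := by
  obtain ⟨A, hApos, hAle, hngA, hglob⟩ := hB 𝒜 hs hc u₀ hdiv hng
  have hdivA : VectorCalculus.IsDivFree ⇑(A • u₀) := by
    intro x
    have hd : DifferentiableAt ℝ (⇑u₀) x := (u₀.differentiable).differentiableAt
    have hcoe : (⇑(A • u₀) : EuclideanSpace ℝ (Fin 3) → EuclideanSpace ℝ (Fin 3)) =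
        A • (⇑u₀) := rfl
    unfold VectorCalculus.divergence
    rw [hcoe, fderiv_const_smul hd A, ContinuousLinearMap.coe_smul, map_smul]
    have h0 := hdiv x
    unfold VectorCalculus.divergence at h0
    rw [h0, smul_zero]
  obtain ⟨T, hT, u, hu, hnext⟩ := hmax 𝒜 hs hc (A • u₀) hdivA hngA
  have hglob' : ∀ A' : ℝ, 0 ≤ A' → A' < 1 →
      ∃ u : ℝ → L2C, 𝒜.IsMildSolution (schwartzL2 (A' • (A • u₀))) (Ici 0) u := by
    intro A' h0 h1
    have := hglob (A' * A) (by positivity) (by nlinarith)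
    simpa [smul_smul] using this
  obtain ⟨M, hM⟩ := hR (A • u₀) hdivA hglob' T hT u hu hnext
  exact ⟨𝒜, hs, hc, A • u₀, hdivA, T, hT, u, hu, ⟨M, hM⟩, hnext⟩

/-! ### Card 2 (haar-dilation-selfsimilar): continuous scaling covariance inside the class. -/

/-- FIRST LEMMA of card `haar-dilation-selfsimilar`: a datum whose form is covariant under ONE
dilation ratio `lam₀ > 1` (every Tao cascade datum is, by construction) can be re-averaged over
`λ ∈ [1, lam₀)` with the Haar weight `λ^{-5/2} dλ/λ` INSIDE the averaging class, producing a
datum covariant under ALL dilations (the Euler scaling law `⟨B(u_λ,v_λ),w_λ⟩ = λ^{5/2}⟨B(u,v),w⟩`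
for the unitary `Dil_λ`), with symmetry and cancellation inherited. -/
def HaarDilationUpgrade : Prop :=
  ∀ (𝒜 : AveragingDatum) (lam₀ : ℝ), 1 < lam₀ →
    (∀ u v w : L2C, MemH10df u → MemH10df v → MemH10df w →
        𝒜.form (dil lam₀ u) (dil lam₀ v) (dil lam₀ w) = ((lam₀ ^ ((5:ℝ)/2) : ℝ) : ℂ) * 𝒜.form u v w) →
    ∃ 𝒜' : AveragingDatum,
      (𝒜.IsSymmetric → 𝒜'.IsSymmetric) ∧ (𝒜.HasCancellation → 𝒜'.HasCancellation) ∧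
      (∀ u v w : L2C, MemH10df u → MemH10df v → MemH10df w →
        𝒜'.form u v w = (Real.log lam₀)⁻¹ *
          ∫ l in (1:ℝ)..lam₀, (((l ^ (-(7:ℝ)/2)) : ℝ) : ℂ) * 𝒜.form (dil l u) (dil l v) (dil l w)) ∧
      ∀ s : ℝ, 0 < s → ∀ u v w : L2C, MemH10df u → MemH10df v → MemH10df w →
        𝒜'.form (dil s u) (dil s v) (dil s w) = ((s ^ ((5:ℝ)/2) : ℝ) : ℂ) * 𝒜'.form u v w

/-- The self-similar reduction the upgrade buys (second statement of the line): for a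
continuously covariant datum, a profile `U ∈ H¹⁰_df` solving the stationary similarity equation
in duality form yields the exactly self-similar mild solution `u(t) = Dil_{(T-t)^{-1/2}} U`
scaled by `(T-t)^{1/4}` (unitary-dilation bookkeeping: `(T-t)^{-1/2} U(x/√(T-t)) =
(T-t)^{1/4} Dil_{(T-t)^{-1/2}} U`), with the Type-I rate automatic. Stated loosely as an
existence claim over the class (the profile equation itself needs an `L²`-duality rendering
of `Δ - ½ y·∇ - ½`, deferred: definition request if the card is picked). -/
def SelfSimilarWitness : Prop :=
  ∃ 𝒜 : AveragingDatum, 𝒜.IsSymmetric ∧ 𝒜.HasCancellation ∧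
    (∀ s : ℝ, 0 < s → ∀ u v w : L2C, MemH10df u → MemH10df v → MemH10df w →
        𝒜.form (dil s u) (dil s v) (dil s w) = ((s ^ ((5:ℝ)/2) : ℝ) : ℂ) * 𝒜.form u v w) ∧
    ∃ (U : L2C) (T : ℝ), 0 < T ∧ U ≠ 0 ∧
      𝒜.IsMildSolution (((T ^ ((1:ℝ)/4) : ℝ) : ℂ) • dil (T ^ (-(1:ℝ)/2)) U) (Ico 0 T)
        (fun t => (((T - t) ^ ((1:ℝ)/4) : ℝ) : ℂ) • dil ((T - t) ^ (-(1:ℝ)/2)) U)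

/-! ### Card 3 (attracting-type-i-cycle): an OPEN set of single-mode data blows up at the
Type-I rate for a designed Tao circuit (class (4.3), α = 2/5, the route's encoding). -/

/-- FIRST LEMMA of card `attracting-type-i-cycle` (ODE level, in the exact encoding of the
route's `CircuitPump`/`CircuitTrace` class): there is a Tao circuit (fine ratio allowed) and an
open INTERVAL of amplitudes such that every single-mode datum `A·e_{i₀}` at scale `0` blows up in
finite time with the Type-I weight `lam^{3n/5}|X_{i,n}(t)| √(T-t)` bounded — robust
(open-basin) Type-I blow-up, the signature of an attracting renormalised cycle. -/
def RobustTypeICircuit : Prop :=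
  ∀ lam₀ : ℝ, 1 < lam₀ → ∃ lam : ℝ, 1 < lam ∧ lam < lam₀ ∧
    ∃ (m : ℕ) (coeff : Fin m → Fin m → Fin m → Option (Fin 3) → ℝ) (i₀ : Fin m) (A₁ A₂ : ℝ),
      0 < A₁ ∧ A₁ < A₂ ∧
      (∀ (i₁ i₂ i₃ : Fin m) (μ : Option (Fin 3)),
          coeff i₁ i₂ i₃ μ = coeff i₂ i₁ i₃ (Option.map (Equiv.swap (0 : Fin 3) 1) μ)) ∧
      (∀ (v : Fin 3 → Fin m) (μ : Option (Fin 3)),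
          ∑ σ : Equiv.Perm (Fin 3), coeff (v (σ 0)) (v (σ 1)) (v (σ 2)) (Option.map σ.symm μ) = 0) ∧
      ∀ A : ℝ, A₁ < A → A < A₂ →
        ∃ (T : ℝ) (X : Fin m → ℤ → ℝ → ℝ),
          let F : Fin m → ℤ → ℝ → ℝ := fun (i : Fin m) (n : ℤ) (t : ℝ) =>
            -(lam ^ ((4 / 5 : ℝ) * n)) * X i n t +
              ∑ i₁ : Fin m, ∑ i₂ : Fin m, ∑ μ : Option (Fin 3),
                coeff i₁ i₂ i μ * lam ^ ((n : ℝ) - (if μ = some 2 then 1 else 0)) *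
                  X i₁ (n + ((if μ = some 0 then 1 else 0) - (if μ = some 2 then 1 else 0))) t *
                  X i₂ (n + ((if μ = some 1 then 1 else 0) - (if μ = some 2 then 1 else 0))) t
          -- X is the (unique) classical solution on [0,T) from the single-mode datum A·e_{i₀,0},
          -- H¹⁰-regular on compacts, blowing up at T, and obeying the Type-I (L^∞-weight) bound:
          0 < T ∧
          (∀ (i : Fin m) (n : ℤ), ContinuousOn (X i n) (Ico 0 T)) ∧
          (∀ (i : Fin m) (n : ℤ), ∀ t ∈ Ioo 0 T, HasDerivAt (X i n) (F i n t) t) ∧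
          (∀ (i : Fin m) (n : ℤ), X i n 0 = if i = i₀ ∧ n = 0 then A else 0) ∧
          (∀ (i : Fin m) (n : ℤ) (t : ℝ), n < 0 → X i n t = 0) ∧
          (∀ T' ∈ Ioo 0 T, ∃ C : ℝ, ∀ (i : Fin m) (n : ℤ), ∀ t ∈ Icc 0 T',
              lam ^ ((4 : ℝ) * n) * |X i n t| ≤ C) ∧
          (¬ ∃ C : ℝ, ∀ (i : Fin m) (n : ℤ), ∀ t ∈ Ico 0 T, lam ^ ((4 : ℝ) * n) * |X i n t| ≤ C) ∧
          ∃ M : ℝ, ∀ (i : Fin m) (n : ℤ), ∀ t ∈ Ico 0 T,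
            lam ^ ((3 / 5 : ℝ) * n) * |X i n t| * Real.sqrt (T - t) ≤ M

end Summit.NavierStokesRegularity.NavierStokesRegularity.Cruxes.AveragedTypeIBlowup.SketchR1K2
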